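import Summits.Ventures.PercRepro.ProfilePointedCircuitClassesStarSharpD0S

/-!
# PercRepro — CASE D0 OF `StarNineSharp`, PART T: TWO R4b′ DEMANDS, NO R4a′ DEMAND (THE TYPE-δ CONFIGURATIONS)
(p5, gen 54; `proofs/P5-GM1.md` §81 ADD 3, 6, 12)

`inCount_thru_le_of_no_on_line_e_of_two_R4b`: no ON line through `e`, an ON plane `H` through `e, f`; the `ef`-plane
demands have no R4a′ member and at most two members; one ON target `{e, f, c} + b` (a C-point `c` of `H`) and one
R4c bi-basis `{x, w} + e + f` (pair not an ON demand) exist. Then the `ef`-plane bound `hHcls` of module D0R holds by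
counting: at most 2 demands, at least 1 + 1 targets. These are the six type-δ configurations of §81 ADD 3 (class 166).
-/

open scoped Matroid

namespace PercRepro.Cogirth

open Finset ThmH Skew Shadow Profile

open Classical

variable {α : Type} [DecidableEq α] {N : Matroid α} [N.Finite]

section StarSharpD0T

variable {b b' : α}

omit [DecidableEq α] in
/-- A finset without three distinct elements has at most two elements. -/
theorem card_le_two_of_no_three {s : Finset α} (h : ∀ x ∈ s, ∀ y ∈ s, ∀ z ∈ s, x = y ∨ x = z ∨ y = z) :
    s.card ≤ 2 := by
  by_contra hlt
  push Not at hlt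
  obtain ⟨x, y, z, hx, hy, hz, hxy, hxz, hyz⟩ := two_lt_card_iff.1 hlt
  rcases h x hx y hy z hz with h1 | h1 | h1
  · exact hxy h1
  · exact hxz h1
  · exact hyz h1

/-- **THE TYPE-δ CONFIGURATIONS**: no R4a′ demand, at most two `ef`-plane demands, one ON target `{e, f, c} + b` and
one R4c bi-basis available; then the `b′`-avoiding inequality holds. -/
theorem inCount_thru_le_of_no_on_line_e_of_two_R4b (hn : (gr N).card = 9) (hR : rk N (gr N) = 5)
    (hcf : ∀ x ∈ gr N, rk N ((gr N).erase x) = 5) (h : SeriesPair N b b')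
    {e f : α} (he : e ∈ gr N) (hf : f ∈ gr N) (hef : e ≠ f) (heb : e ≠ b) (heb' : e ≠ b') (hfb : f ≠ b) (hfb' : f ≠ b')
    (hE7 : rk N (((gr N).erase b).erase b') = 4)
    (hnle : ∀ S : Finset α, S ⊆ ((gr N).erase b).erase b' → e ∈ S → rk N (insert b (insert b' S)) ≤ 3 → rk N S ≤ 1)
    (he1 : ∀ y ∈ ((((gr N).erase b).erase b').erase f).erase e, rk N {e, y} = 2)
    (hfc : ∀ y ∈ ((((gr N).erase b).erase b').erase f).erase e, rk N (((((gr N).erase b).erase b').erase f).erase y) = 4)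
    (hX : rk N (((((gr N).erase b).erase b').erase f).erase e) = 4)
    (htwo : ∀ W₁ ∈ d0DON N b' e f, ∀ W₂ ∈ d0DON N b' e f, ∀ W₃ ∈ d0DON N b' e f,
      ¬ d0c0 N b b' e f W₁ → ¬ d0c1 N b e f W₁ → ¬ d0c0 N b b' e f W₂ → ¬ d0c1 N b e f W₂ →
      ¬ d0c0 N b b' e f W₃ → ¬ d0c1 N b e f W₃ → W₁ = W₂ ∨ W₁ = W₃ ∨ W₂ = W₃)
    (hCon : ∃ W ∈ biIndepSets N 4, (f ∈ W ∧ b' ∉ W) ∧ (e ∈ W ∧ b ∈ W ∧ ¬ (gr N \ W).erase b' ∈ biIndepSets N 4))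
    (hR4c : ∃ B ∈ biIndepSets N 4, ((f ∈ B ∧ b' ∉ B) ∧ (e ∈ B ∧ b ∉ B)) ∧
      ¬ (insert b (B.erase f) ∈ biIndepSets N 4 ∧ rk N (insert b (insert b' (B.erase f))) = 4)) :
    inCount N 4 e + thruCount N 4 {b', f} + thruCount N 4 {b', e, f} ≤
      inCount N 4 f + thruCount N 4 {e, f} + thruCount N 4 {b', e} := by
  apply inCount_thru_le_of_no_on_line_e_of_H_bound hn hR hcf h he hf hef heb heb' hfb hfb' hE7 hnle he1 hfc hX
  have h2 : ((d0DON N b' e f).filter (fun W => ¬ d0c0 N b b' e f W ∧ ¬ d0c1 N b e f W)).card ≤ 2 := by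
    apply card_le_two_of_no_three
    intro x hx y hy z hz
    simp only [mem_filter] at hx hy hz
    exact htwo x hx.1 y hy.1 z hz.1 hx.2.1 hx.2.2 hy.2.1 hy.2.2 hz.2.1 hz.2.2
  obtain ⟨W, hW, hW'⟩ := hCon
  obtain ⟨B, hB, hB'⟩ := hR4c
  have h3 : 1 ≤ ((biIndepSets N 4).filter (fun W => (f ∈ W ∧ b' ∉ W) ∧
      (e ∈ W ∧ b ∈ W ∧ ¬ (gr N \ W).erase b' ∈ biIndepSets N 4))).card :=
    card_pos.2 ⟨W, mem_filter.2 ⟨hW, hW'⟩⟩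
  have h4 : 1 ≤ ((biIndepSets N 4).filter (fun B => ((f ∈ B ∧ b' ∉ B) ∧ (e ∈ B ∧ b ∉ B)) ∧
      ¬ (insert b (B.erase f) ∈ biIndepSets N 4 ∧ rk N (insert b (insert b' (B.erase f))) = 4))).card :=
    card_pos.2 ⟨B, mem_filter.2 ⟨hB, hB'⟩⟩
  omega

end StarSharpD0T

end PercRepro.Cogirth
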